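import Literature.Barriers.CriticalPhenomena.GridSAWTowers
import HarnessLib

/-!
# Barrier `GridSAWCountingSharpPComplete`, tower step: the edge set of the new paths, and a
# worked instance with towers

Sibling of `GridSAWTowers.lean` ((T1): `newPath`, `uniformize`, `isGridDrawing_uniformize`) and
input to the machine part (T3) of `LOT2003_thm7_fixedLength_towers`: the `FP` instance map emits
the unit edges of the new paths one at a time, in an order of its own, and its correctness is
checked against the SET of consecutive pairs of `newPath` (counts depend on an edge list only
through vertex set and adjacency). This file characterises that set:

* `pathEdges_cons`, `pathEdges_append`, `mem_pathEdges_append` (both parts and the junction pair),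
  `mem_pathEdges_map_range`;
* `mem_pathEdges_tower` (up the first column, across, down the second), `getLast?_runBlock`,
  `mem_pathEdges_runFrom`, `getLast?_runFrom`, `mem_pathEdges_scalePath` (the `M` unit steps of
  each enlarged unit edge), `towerOffsets_lt`;
* **`mem_pathEdges_newPath`**: a pair is consecutive on `newPath Λ T (p :: q :: l)` iff it is a
  run step `(runPt t, runPt (t+1))` of some unit edge — on the first unit edge only for `t` not a
  tower offset — or one of the pairs around and inside a tower at an offset `o`:
  `(runPt o, towerPt o 1)`, the tower's own pairs, `(towerPt (o+1) 1, runPt (o+1))`;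
* a worked instance exercising the towers (review advisory on `GridSAWTowers.lean`): the two-edge
  drawing `twoEdgeDrawing` (`Λ = 2`, its first edge receives two towers) is a grid drawing, its
  uniformisation is again one, with all paths of `97 = 24·2² + 1` points.

## References

* M. Liśkiewicz, M. Ogihara, S. Toda, *The complexity of counting self-avoiding walks in
  subgraphs of two-dimensional grids and hypercubes*, TCS 304 (2003), §4 (proof of Theorem 7, E₂).
-/

namespace Literature.Barriers.CriticalPhenomena.GridSAW

/-- `pathEdges` of a cons: the first pair (if any) then the rest. [folklore] -/
theorem pathEdges_cons (x : GridPoint) (l : List GridPoint) :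
    pathEdges (x :: l) = (match l with | [] => [] | y :: _ => [(x, y)]) ++ pathEdges l := by
  cases l <;> rfl

/-- `pathEdges` of an append: both parts and the junction pair. [folklore] -/
theorem pathEdges_append : ∀ (l₁ l₂ : List GridPoint),
    pathEdges (l₁ ++ l₂) = pathEdges l₁ ++ (match l₁.getLast?, l₂.head? with
      | some a, some b => [(a, b)] | _, _ => []) ++ pathEdges l₂
  | [], l₂ => by cases l₂ <;> rfl
  | [a], l₂ => by cases l₂ <;> rfl
  | a :: b :: l₁, l₂ => by
    rw [List.cons_append, List.cons_append, pathEdges_cons_cons, ← List.cons_append, pathEdges_append (b :: l₁) l₂,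
      pathEdges_cons_cons]
    simp [List.getLast?_cons_cons]

/-- Membership in `pathEdges` of an append. [folklore] -/
theorem mem_pathEdges_append {l₁ l₂ : List GridPoint} {e : GridPoint × GridPoint} :
    e ∈ pathEdges (l₁ ++ l₂) ↔ e ∈ pathEdges l₁ ∨ (∃ a b, l₁.getLast? = some a ∧ l₂.head? = some b ∧ e = (a, b)) ∨ e ∈ pathEdges l₂ := by
  rw [pathEdges_append, List.mem_append, List.mem_append, or_assoc]
  refine or_congr Iff.rfl (or_congr ?_ Iff.rfl)
  cases h1 : l₁.getLast? <;> cases h2 : l₂.head? <;> simp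

/-- Consecutive pairs of a mapped range. [folklore] -/
theorem mem_pathEdges_map_range {f : ℕ → GridPoint} {n : ℕ} {x y : GridPoint} :
    (x, y) ∈ pathEdges ((List.range n).map f) ↔ ∃ k, k + 1 < n ∧ f k = x ∧ f (k + 1) = y := by
  rw [mem_pathEdges_iff]
  simp only [List.length_map, List.length_range, List.getElem_map, List.getElem_range]
  exact ⟨fun ⟨i, hi, hx, hy⟩ => ⟨i, hi, hx, hy⟩, fun ⟨i, hi, hx, hy⟩ => ⟨i, hi, hx, hy⟩⟩

/-- **The consecutive pairs of a tower** (`h ≥ 1`): up the first column, across the top, down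
the second column. [folklore] -/
theorem mem_pathEdges_tower (M : ℕ) (a u : GridPoint) (o : ℕ) {h : ℕ} (hh : 1 ≤ h) {x y : GridPoint} :
    (x, y) ∈ pathEdges (tower M a u o h) ↔
      (∃ k, 1 ≤ k ∧ k < h ∧ x = towerPt M a u o k ∧ y = towerPt M a u o (k + 1)) ∨
      (x = towerPt M a u o h ∧ y = towerPt M a u (o + 1) h) ∨
      (∃ k, 1 ≤ k ∧ k < h ∧ x = towerPt M a u (o + 1) (k + 1) ∧ y = towerPt M a u (o + 1) k) := by
  rw [tower, mem_pathEdges_append, List.map_reverse, mem_pathEdges_reverse, mem_pathEdges_map_range,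
    mem_pathEdges_map_range, List.getLast?_map, List.getLast?_range, List.head?_reverse, List.getLast?_map,
    List.getLast?_range]
  have hne : h ≠ 0 := by omega
  simp only [hne, ↓reduceIte, Option.map_some, Option.some.injEq, Prod.mk.injEq, existsAndEq, true_and, Nat.sub_add_cancel hh]
  refine or_congr ?_ (or_congr ?_ ?_)
  · constructor
    · rintro ⟨k, hk, rfl, rfl⟩; exact ⟨k + 1, by omega, by omega, rfl, rfl⟩
    · rintro ⟨k, hk1, hk, rfl, rfl⟩; exact ⟨k - 1, by omega, by rw [Nat.sub_add_cancel hk1], by rw [Nat.sub_add_cancel hk1]⟩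
  · exact Iff.rfl
  · constructor
    · rintro ⟨k, hk, rfl, rfl⟩; exact ⟨k + 1, by omega, by omega, rfl, rfl⟩
    · rintro ⟨k, hk1, hk, rfl, rfl⟩; exact ⟨k - 1, by omega, by rw [Nat.sub_add_cancel hk1], by rw [Nat.sub_add_cancel hk1]⟩

/-- The last point of a block. [folklore] -/
theorem getLast?_runBlock (M : ℕ) (a u : GridPoint) (offs : List ℕ) {h : ℕ} (hh : 1 ≤ h) (t : ℕ) :
    (runBlock M a u offs h t).getLast? = some (if t ∈ offs then towerPt M a u (t + 1) 1 else runPt M a u t) := by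
  rw [runBlock]
  split_ifs with ht
  · rw [List.getLast?_cons, getLast?_tower M a u t hh]; rfl
  · rfl

/-- **The consecutive pairs of the run with towers** from index `t`, `n` blocks. [folklore] -/
theorem mem_pathEdges_runFrom (M : ℕ) (a u : GridPoint) (offs : List ℕ) {h : ℕ} (hh : 1 ≤ h) {x y : GridPoint} :
    ∀ {n t : ℕ}, (x, y) ∈ pathEdges (runFrom M a u offs h t n) ↔
      ∃ s, t ≤ s ∧ s < t + n ∧
        ((s ∉ offs ∧ s + 1 < t + n ∧ x = runPt M a u s ∧ y = runPt M a u (s + 1)) ∨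
         (s ∈ offs ∧ ((x = runPt M a u s ∧ y = towerPt M a u s 1) ∨ (x, y) ∈ pathEdges (tower M a u s h) ∨
            (s + 1 < t + n ∧ x = towerPt M a u (s + 1) 1 ∧ y = runPt M a u (s + 1)))))
  | 0, t => by
    simp only [runFrom, pathEdges_nil, List.not_mem_nil, add_zero, false_iff, not_exists, not_and]
    intro s hs hs'; omega
  | n + 1, t => by
    rw [runFrom, mem_pathEdges_append, mem_pathEdges_runFrom M a u offs hh (n := n) (t := t + 1), getLast?_runBlock M a u offs hh t]
    have hblock : (x, y) ∈ pathEdges (runBlock M a u offs h t) ↔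
        t ∈ offs ∧ ((x = runPt M a u t ∧ y = towerPt M a u t 1) ∨ (x, y) ∈ pathEdges (tower M a u t h)) := by
      rw [runBlock]
      split_ifs with ht
      · rw [show runPt M a u t :: tower M a u t h = [runPt M a u t] ++ tower M a u t h from rfl, mem_pathEdges_append,
          head?_tower M a u t hh]
        simp [ht]
      · simp [ht]
    have hhead : ∀ {m : ℕ}, (runFrom M a u offs h (t + 1) m).head? = if m = 0 then none else some (runPt M a u (t + 1)) := by
      intro m
      rcases Nat.eq_zero_or_pos m with rfl | hm
      · rfl
      · rw [head?_runFrom M a u offs h (t + 1) hm, if_neg (by omega)]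
    rw [hblock, hhead]
    constructor
    · rintro (⟨ht, hxy⟩ | ⟨a', b', ha', hb', hab⟩ | ⟨s, hs, hs', hcase⟩)
      · exact ⟨t, le_rfl, by omega, Or.inr ⟨ht, hxy.elim Or.inl (fun h => Or.inr (Or.inl h))⟩⟩
      · rcases Nat.eq_zero_or_pos n with rfl | hn
        · simp at hb'
        · rw [if_neg (by omega)] at hb'
          simp only [Option.some.injEq, Prod.mk.injEq] at ha' hb' hab
          obtain ⟨rfl, rfl⟩ := hab
          refine ⟨t, le_rfl, by omega, ?_⟩
          split_ifs at ha' with ht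
          · exact Or.inr ⟨ht, Or.inr (Or.inr ⟨by omega, ha'.symm, hb'.symm⟩)⟩
          · exact Or.inl ⟨ht, by omega, ha'.symm, hb'.symm⟩
      · refine ⟨s, by omega, by omega, ?_⟩
        rcases hcase with ⟨hs1, hs2, hx, hy⟩ | ⟨hs1, hc⟩
        · exact Or.inl ⟨hs1, by omega, hx, hy⟩
        · exact Or.inr ⟨hs1, hc.imp id (Or.imp id fun ⟨h1, h2, h3⟩ => ⟨by omega, h2, h3⟩)⟩
    · rintro ⟨s, hs, hs', hcase⟩
      rcases Nat.eq_or_lt_of_le hs with rfl | hlt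
      · rcases hcase with ⟨ht, hn, rfl, rfl⟩ | ⟨ht, h1 | h1 | ⟨hn, rfl, rfl⟩⟩
        · exact Or.inr (Or.inl ⟨_, _, by rw [if_neg ht], by rw [if_neg (by omega)], rfl⟩)
        · exact Or.inl ⟨ht, Or.inl h1⟩
        · exact Or.inl ⟨ht, Or.inr h1⟩
        · exact Or.inr (Or.inl ⟨_, _, by rw [if_pos ht], by rw [if_neg (by omega)], rfl⟩)
      · refine Or.inr (Or.inr ⟨s, hlt, by omega, ?_⟩)
        rcases hcase with ⟨hs1, hs2, hx, hy⟩ | ⟨hs1, hc⟩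
        · exact Or.inl ⟨hs1, by omega, hx, hy⟩
        · exact Or.inr ⟨hs1, hc.imp id (Or.imp id fun ⟨h1, h2, h3⟩ => ⟨by omega, h2, h3⟩)⟩

/-- The last point of the blocks from `t` on (`n ≥ 1` blocks, `h ≥ 1`). [folklore] -/
theorem getLast?_runFrom (M : ℕ) (a u : GridPoint) (offs : List ℕ) {h : ℕ} (hh : 1 ≤ h) :
    ∀ {n : ℕ} (t : ℕ), 1 ≤ n → (runFrom M a u offs h t n).getLast? =
      some (if t + n - 1 ∈ offs then towerPt M a u (t + n) 1 else runPt M a u (t + n - 1))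
  | 0, t, hn => by omega
  | n + 1, t, _ => by
    rw [runFrom, List.getLast?_append]
    rcases Nat.eq_zero_or_pos n with rfl | hn
    · rw [runFrom, List.getLast?_nil, Option.none_or, getLast?_runBlock M a u offs hh t]; simp
    · rw [getLast?_runFrom M a u offs hh (t + 1) hn, Option.some_or]
      have e1 : t + 1 + n = t + (n + 1) := by omega
      simp only [e1]

/-- **The consecutive pairs of a scaled path**: the `M` unit steps of each enlarged unit edge.
[folklore] -/
theorem mem_pathEdges_scalePath {M : ℕ} (hM : 1 ≤ M) {x y : GridPoint} : ∀ (p : GridPoint) (l : List GridPoint),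
    (x, y) ∈ pathEdges (scalePath M (p :: l)) ↔
      ∃ i : ℕ, ∃ hi : i + 1 < (p :: l).length, ∃ t < M,
        x = runPt M ((p :: l)[i]'(by omega)) ((p :: l)[i + 1] - (p :: l)[i]'(by omega)) t ∧
        y = runPt M ((p :: l)[i]'(by omega)) ((p :: l)[i + 1] - (p :: l)[i]'(by omega)) (t + 1)
  | p, [] => by simp [scalePath]
  | p, q :: l => by
    rw [scalePath, mem_pathEdges_append, mem_pathEdges_runFrom M p (q - p) [] le_rfl,
      getLast?_runFrom M p (q - p) [] le_rfl 0 hM, head?_scalePath hM, mem_pathEdges_scalePath hM q l]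
    simp only [List.not_mem_nil, not_false_eq_true, true_and, false_and, or_false, Nat.zero_add, ↓reduceIte,
      Option.some.injEq, Prod.mk.injEq, existsAndEq, List.length_cons]
    constructor
    · rintro (⟨s, -, hs, hs', rfl, rfl⟩ | ⟨hx, hy⟩ | ⟨i, hi, t, ht, rfl, rfl⟩)
      · exact ⟨0, by omega, s, hs, by simp, by simp⟩
      · refine ⟨0, by omega, M - 1, by omega, ?_, ?_⟩
        · rw [hx]; simp
        · rw [hy, Nat.sub_add_cancel hM]; simp [runPt_self]
      · exact ⟨i + 1, by omega, t, ht, by simp, by simp⟩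
    · rintro ⟨i, hi, t, ht, rfl, rfl⟩
      cases i with
      | zero =>
        by_cases hlast : t + 1 < M
        · exact Or.inl ⟨t, Nat.zero_le _, ht, hlast, by simp, by simp⟩
        · have htM : t = M - 1 := by omega
          subst htM
          refine Or.inr (Or.inl ⟨by simp, ?_⟩)
          rw [Nat.sub_add_cancel hM, List.getElem_cons_zero, List.getElem_cons_succ, List.getElem_cons_zero, runPt_self]
          simp
      | succ i => exact Or.inr (Or.inr ⟨i, by omega, t, ht, by simp, by simp⟩)

/-- The tower offsets leave the last block of the first run alone: `o ∈ towerOffsets Λ T` (with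
`T ≤ 2Λ`) has `o + 1 < M - 1`. [folklore] -/
theorem towerOffsets_lt {Λ T o : ℕ} (hT : T ≤ 2 * Λ) (ho : o ∈ towerOffsets Λ T) : o + 2 < bigM Λ := by
  obtain ⟨j, hj, rfl⟩ := mem_towerOffsets.1 ho; unfold bigM; omega

/-- **The consecutive pairs of the new path**: run steps (all of them on the later unit edges, the
ones not replaced by a tower on the first), and the pairs around and inside the towers. [folklore] -/
theorem mem_pathEdges_newPath {Λ T : ℕ} (hΛ : 1 ≤ Λ) (hT : T ≤ 2 * Λ) {x y : GridPoint} (p q : GridPoint) (l : List GridPoint) :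
    (x, y) ∈ pathEdges (newPath Λ T (p :: q :: l)) ↔
      (∃ i : ℕ, ∃ hi : i + 1 < (p :: q :: l).length, ∃ t < bigM Λ, (i ≠ 0 ∨ t ∉ towerOffsets Λ T) ∧
        x = runPt (bigM Λ) ((p :: q :: l)[i]'(by omega)) ((p :: q :: l)[i + 1] - (p :: q :: l)[i]'(by omega)) t ∧
        y = runPt (bigM Λ) ((p :: q :: l)[i]'(by omega)) ((p :: q :: l)[i + 1] - (p :: q :: l)[i]'(by omega)) (t + 1)) ∨
      (∃ o ∈ towerOffsets Λ T, (x = runPt (bigM Λ) p (q - p) o ∧ y = towerPt (bigM Λ) p (q - p) o 1) ∨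
        (x, y) ∈ pathEdges (tower (bigM Λ) p (q - p) o (6 * Λ)) ∨
        (x = towerPt (bigM Λ) p (q - p) (o + 1) 1 ∧ y = runPt (bigM Λ) p (q - p) (o + 1))) := by
  have hM : 1 ≤ bigM Λ := by unfold bigM; omega
  have hh : 1 ≤ 6 * Λ := by omega
  have hlast : bigM Λ - 1 ∉ towerOffsets Λ T := fun h => by have := towerOffsets_lt hT h; omega
  rw [newPath, mem_pathEdges_append, runWithTowers, mem_pathEdges_runFrom _ p (q - p) _ hh,
    getLast?_runFrom _ p (q - p) _ hh 0 hM, head?_scalePath hM, mem_pathEdges_scalePath hM q l]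
  simp only [Nat.zero_add, hlast, ↓reduceIte, Option.some.injEq, Prod.mk.injEq, existsAndEq, List.length_cons, true_and,
    Nat.zero_le]
  constructor
  · rintro (⟨s, hs, hcase⟩ | ⟨hx, hy⟩ | ⟨i, hi, t, ht, rfl, rfl⟩)
    · rcases hcase with ⟨hs1, hs2, rfl, rfl⟩ | ⟨hs1, hc⟩
      · exact Or.inl ⟨0, by omega, s, hs, Or.inr hs1, by simp, by simp⟩
      · refine Or.inr ⟨s, hs1, ?_⟩
        rcases hc with h1 | h1 | ⟨-, h2, h3⟩
        · exact Or.inl h1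
        · exact Or.inr (Or.inl h1)
        · exact Or.inr (Or.inr ⟨h2, h3⟩)
    · refine Or.inl ⟨0, by omega, bigM Λ - 1, by omega, Or.inr hlast, ?_, ?_⟩
      · rw [hx]; simp
      · rw [hy, Nat.sub_add_cancel hM]; simp [runPt_self]
    · exact Or.inl ⟨i + 1, by omega, t, ht, Or.inl (by omega), by simp, by simp⟩
  · rintro (⟨i, hi, t, ht, hit, rfl, rfl⟩ | ⟨o, ho, hcase⟩)
    · cases i with
      | zero =>
        have ht' : t ∉ towerOffsets Λ T := hit.resolve_left (fun h => h rfl)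
        by_cases hl : t + 1 < bigM Λ
        · exact Or.inl ⟨t, ht, Or.inl ⟨ht', hl, by simp, by simp⟩⟩
        · have htM : t = bigM Λ - 1 := by omega
          subst htM
          refine Or.inr (Or.inl ⟨by simp, ?_⟩)
          rw [Nat.sub_add_cancel hM, List.getElem_cons_zero, List.getElem_cons_succ, List.getElem_cons_zero, runPt_self]; simp
      | succ i => exact Or.inr (Or.inr ⟨i, by omega, t, ht, by simp, by simp⟩)
    · have ho2 := towerOffsets_lt hT ho
      refine Or.inl ⟨o, by omega, Or.inr ⟨ho, ?_⟩⟩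
      rcases hcase with h1 | h1 | ⟨h2, h3⟩
      · exact Or.inl h1
      · exact Or.inr (Or.inl h1)
      · exact Or.inr (Or.inr ⟨by omega, h2, h3⟩)

/-! ### A worked instance with towers -/

/-- The path graph `0 — 1 — 2` drawn on the `x`-axis with edges of one and two unit steps
(`Λ = 2`): the first edge will receive `towerCount 2 _ = 2` towers. [folklore] -/
def twoEdgeDrawing : List GridPoint × List DrawnEdge :=
  ([((0 : ℤ), (0 : ℤ)), (1, 0), (3, 0)], [(0, 1, [((0 : ℤ), (0 : ℤ)), (1, 0)]), (1, 2, [((1 : ℤ), (0 : ℤ)), (2, 0), (3, 0)])])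

/-- It is a congestion-free grid drawing. [folklore] -/
theorem isGridDrawing_twoEdge : IsGridDrawing twoEdgeDrawing.1 twoEdgeDrawing.2 := by decide

/-- `Λ = 2`, and the first edge receives two towers. [folklore] -/
theorem maxEdges_twoEdge : maxEdges twoEdgeDrawing.2 = 2 ∧ towerCount 2 (0, 1, [((0 : ℤ), (0 : ℤ)), (1, 0)]) = 2 := by decide

/-- The uniformised two-edge drawing is a grid drawing … [folklore] -/
theorem isGridDrawing_uniformize_twoEdge :
    IsGridDrawing (uniformize twoEdgeDrawing.1 twoEdgeDrawing.2).1 (uniformize twoEdgeDrawing.1 twoEdgeDrawing.2).2 :=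
  isGridDrawing_uniformize isGridDrawing_twoEdge

/-- … with all paths of `97 = 24 · 2² + 1` points (the first one through its two towers). [folklore] -/
theorem length_uniformize_twoEdge :
    ∀ e ∈ (uniformize twoEdgeDrawing.1 twoEdgeDrawing.2).2, e.2.2.length = 97 := by
  intro e he
  have h := length_uniformize isGridDrawing_twoEdge e he
  rw [maxEdges_twoEdge.1] at h
  exact h

end Literature.Barriers.CriticalPhenomena.GridSAW
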